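import Mathlib
import Summits.KontsevichZagierPeriods.KontsevichZagierPeriods.Theorems.SoloInformedTelescopeStep
import HarnessLib
import HarnessLib.Audit

/-!
# SoloInformed — the Möbius telescope STEP in any dimension: the maps `Φ` and `Ψ`

Solo programme `solo-KontsevichZagierPeriods-informed`, session s45 (PART XVI, THEOREM XXXIII).
For a telescope datum `T` (`SoloInformedTelescopeStep`): the polynomial map `Φ : xᵢ ↦ xᵢ ω`
(Jacobian `ω`, `Φ(D₁) = D♯`, `Φ(D) = D₂`, injective on `D`) and the Möbius map
`Ψ : xᵢ ↦ σ(xᵢ) = ω(ω + xᵢ(1 − ω − Qω²))/(1 − Qω²xᵢ)` (Jacobian `ω(1−ω)(1−Qω²)/(1−Qω²xᵢ)²`,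
`Ψ(D) = D♯`, injective on `D`), with the identities `σ − ω²`, `ω − σ`, `1 − Qσ` used by the moves.
Determinants via "identity with one row replaced" (`soloInformed_det_updateRow_one`).

References: Kontsevich–Zagier 2001 §1.2 [KontsevichZagier2001]; Yamamoto arXiv:1405.6499;
Kaneko–Yamamoto arXiv:1605.03117.
-/

noncomputable section

open MeasureTheory Set MvPolynomial
open Literature.ModelTheory.ExponentialFields Literature.NumberTheory.Transcendental
open Literature.NumberTheory.Transcendental.KZ

namespace Summit.KontsevichZagierPeriods.KontsevichZagierPeriods.Theorems

namespace SoloInformedTelDatum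

variable {n : ℕ} (T : SoloInformedTelDatum n)

/-! ## 3. The map `Φ : xᵢ ↦ xᵢ ω` -/

/-- The polynomial tuple of `Φ`. -/
def PΦ : Fin n → MvPolynomial (Fin n) ℚ := Function.update X T.i (X T.i * T.Ω)

/-- Auxiliary (telescope step): `Φ_apply`. -/
theorem Φ_apply (x : Fin n → ℝ) :
    soloInformedPolyMap T.PΦ x = Function.update x T.i (x T.i * T.ω x) := by
  ext j
  by_cases hj : j = T.i
  · subst hj; simp [PΦ, ω]
  · simp [PΦ, hj]

/-- **Jacobian of `Φ`**: `det J_Φ = ω`. -/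
theorem det_Φ (x : Fin n → ℝ) : (soloInformedJacCLM T.PΦ x).det = T.ω x := by
  have hΩ : pderiv T.i T.Ω = 0 := pderiv_eq_zero_of_notMem_vars T.vars_Ω
  have hM : soloInformedJacMat T.PΦ =
      (1 : Matrix (Fin n) (Fin n) (MvPolynomial (Fin n) ℚ)).updateRow T.i
        (fun l => pderiv l (X T.i * T.Ω)) := by
    ext j l
    by_cases hj : j = T.i
    · subst hj; simp [PΦ]
    · simp [PΦ, hj, Matrix.one_apply, pderiv_X, Pi.single_apply, eq_comm]
  rw [soloInformed_det_jacCLM, hM, soloInformed_det_updateRow_one]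
  simp [Derivation.leibniz, hΩ, pderiv_X, ω]

/-- Auxiliary (telescope step): `Φ_mem_D`. -/
theorem Φ_mem_D {x : Fin n → ℝ} (hx : x ∈ T.D) : soloInformedPolyMap T.PΦ x ∈ T.D := by
  rw [Φ_apply]
  exact T.update_mem x hx _ (mul_pos (xi_pos hx) (ω_pos hx))
    (mul_lt_one_of_nonneg_of_lt_one_left (xi_pos hx).le (xi_lt_one hx) (ω_lt_one hx).le)

/-- `Φ(D₁) ⊆ D♯`. -/
theorem Φ_mapsTo_D1 : MapsTo (soloInformedPolyMap T.PΦ) T.D1 T.Ds := by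
  intro x hx
  refine ⟨T.Φ_mem_D hx.1, ?_, ?_⟩
  · rw [Φ_apply, ω_update, Function.update_self]
    have : T.ω x < x T.i := hx.2
    nlinarith [ω_pos hx.1]
  · rw [Φ_apply, ω_update, Function.update_self]
    have := mul_lt_mul_of_pos_right (xi_lt_one hx.1) (ω_pos hx.1)
    linarith

/-- `Φ(D) ⊆ D₂`. -/
theorem Φ_mapsTo_D : MapsTo (soloInformedPolyMap T.PΦ) T.D T.D2 := by
  intro x hx
  refine ⟨T.Φ_mem_D hx, ?_⟩
  show soloInformedPolyMap T.PΦ x T.i < T.ω (soloInformedPolyMap T.PΦ x)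
  rw [Φ_apply, ω_update, Function.update_self]
  have := mul_lt_mul_of_pos_right (xi_lt_one hx) (ω_pos hx)
  linarith

/-- `Φ` is injective on `D`. -/
theorem injOn_Φ : InjOn (soloInformedPolyMap T.PΦ) T.D := by
  intro x hx x' hx' h
  rw [Φ_apply, Φ_apply] at h
  have hoff : ∀ j, j ≠ T.i → x j = x' j := fun j hj => by
    simpa [Function.update_of_ne hj] using congr_fun h j
  have hω : T.ω x = T.ω x' := soloInformed_aeval_eq_of_eq_off T.vars_Ω hoff
  have hi := congr_fun h T.i
  simp only [Function.update_self] at hi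
  rw [hω] at hi
  have hxi : x T.i = x' T.i := mul_right_cancel₀ (ω_pos hx').ne' hi
  ext j
  by_cases hj : j = T.i
  · rw [hj]; exact hxi
  · exact hoff j hj

/-- **`Φ(D₁) = D♯`.** -/
theorem image_Φ_D1 : soloInformedPolyMap T.PΦ '' T.D1 = T.Ds := by
  refine Subset.antisymm (image_subset_iff.2 T.Φ_mapsTo_D1) fun z hz => ?_
  have hzD := hz.1
  have hω := ω_pos hzD
  refine ⟨Function.update z T.i (z T.i / T.ω z), ⟨?_, ?_⟩, ?_⟩
  · exact T.update_mem z hzD _ (div_pos (xi_pos hzD) hω) ((div_lt_one hω).2 hz.2.2)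
  · show T.ω (Function.update z T.i (z T.i / T.ω z)) < Function.update z T.i (z T.i / T.ω z) T.i
    rw [ω_update, Function.update_self, lt_div_iff₀ hω]
    nlinarith [hz.2.1]
  · rw [Φ_apply, ω_update, Function.update_self, Function.update_idem, div_mul_cancel₀ _ hω.ne',
      Function.update_eq_self]

/-- **`Φ(D) = D₂`.** -/
theorem image_Φ_D : soloInformedPolyMap T.PΦ '' T.D = T.D2 := by
  refine Subset.antisymm (image_subset_iff.2 T.Φ_mapsTo_D) fun z hz => ?_
  have hzD := hz.1
  have hω := ω_pos hzD
  have hlt : z T.i < T.ω z := hz.2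
  refine ⟨Function.update z T.i (z T.i / T.ω z), ?_, ?_⟩
  · exact T.update_mem z hzD _ (div_pos (xi_pos hzD) hω) ((div_lt_one hω).2 hlt)
  · rw [Φ_apply, ω_update, Function.update_self, Function.update_idem, div_mul_cancel₀ _ hω.ne',
      Function.update_eq_self]

/-! ## 4. The Möbius map `Ψ : xᵢ ↦ σ(xᵢ)` -/

/-- Numerators of `Ψ`. -/
def PΨ : Fin n → MvPolynomial (Fin n) ℚ :=
  Function.update X T.i (T.Ω * (T.Ω + X T.i * (1 - T.Ω - T.Q * T.Ω ^ 2)))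

/-- Denominators of `Ψ`. -/
def QΨ : Fin n → MvPolynomial (Fin n) ℚ :=
  Function.update (fun _ => 1) T.i (1 - T.Q * T.Ω ^ 2 * X T.i)

/-- Auxiliary (telescope step): `QΨ_ne`. -/
theorem QΨ_ne {x : Fin n → ℝ} (hx : x ∈ T.D) (j : Fin n) : (aeval x (T.QΨ j) : ℝ) ≠ 0 := by
  by_cases hj : j = T.i
  · subst hj
    simpa [QΨ, q, ω] using (one_sub_qωωxi_pos hx).ne'
  · simp [QΨ, hj]

/-- Auxiliary (telescope step): `Ψ_apply`. -/
theorem Ψ_apply {x : Fin n → ℝ} :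
    soloInformedRatMap T.PΨ T.QΨ x = Function.update x T.i (T.sig x) := by
  ext j
  by_cases hj : j = T.i
  · subst hj; simp [PΨ, QΨ, sig, q, ω]
  · simp [PΨ, QΨ, hj]

/-- **Jacobian of `Ψ`**: `det J_Ψ = ω(1 − ω)(1 − Qω²)/(1 − Qω²xᵢ)²`. -/
theorem det_Ψ (x : Fin n → ℝ) :
    (soloInformedRatJacCLM T.PΨ T.QΨ x).det =
      T.ω x * (1 - T.ω x) * (1 - T.q x * T.ω x ^ 2) / (1 - T.q x * T.ω x ^ 2 * x T.i) ^ 2 := by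
  have hΩ : pderiv T.i T.Ω = 0 := pderiv_eq_zero_of_notMem_vars T.vars_Ω
  have hQ : pderiv T.i T.Q = 0 := pderiv_eq_zero_of_notMem_vars T.vars_Q
  have hM : Matrix.of (soloInformedRatJacEntry T.PΨ T.QΨ x) =
      (1 : Matrix (Fin n) (Fin n) ℝ).updateRow T.i
        (fun l => soloInformedRatJacEntry T.PΨ T.QΨ x T.i l) := by
    ext j l
    by_cases hj : j = T.i
    · subst hj; simp
    · simp [soloInformedRatJacEntry, PΨ, QΨ, hj, Matrix.one_apply, pderiv_X, Pi.single_apply,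
        eq_comm]
  rw [soloInformed_det_ratJacCLM, hM, soloInformed_det_updateRow_one]
  simp only [soloInformedRatJacEntry, PΨ, QΨ, Function.update_self]
  simp [Derivation.leibniz, hΩ, hQ, pderiv_X, ω, q]
  ring

section sigma
variable {T} {x : Fin n → ℝ} (hx : x ∈ T.D)
include hx

/-- `σ − ω² = xᵢ ω(1−ω)(1−Qω²)/(1−Qω²xᵢ)`. -/
theorem sig_sub_sq : T.sig x - T.ω x ^ 2 =
    x T.i * T.ω x * (1 - T.ω x) * (1 - T.q x * T.ω x ^ 2) / (1 - T.q x * T.ω x ^ 2 * x T.i) := by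
  rw [sig]
  set d := 1 - T.q x * T.ω x ^ 2 * x T.i with hd_def
  have hd : d ≠ 0 := (one_sub_qωωxi_pos hx).ne'
  rw [eq_div_iff hd, div_sub' hd, div_mul_cancel₀ _ hd, hd_def]
  ring

/-- `ω − σ = ω(1−xᵢ)(1−ω)/(1−Qω²xᵢ)`. -/
theorem ω_sub_sig : T.ω x - T.sig x =
    T.ω x * (1 - x T.i) * (1 - T.ω x) / (1 - T.q x * T.ω x ^ 2 * x T.i) := by
  rw [sig]
  set d := 1 - T.q x * T.ω x ^ 2 * x T.i with hd_def
  have hd : d ≠ 0 := (one_sub_qωωxi_pos hx).ne'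
  rw [eq_div_iff hd, sub_div' hd, div_mul_cancel₀ _ hd, hd_def]
  ring

/-- `1 − Qσ = (1−Qω²)(1−Qωxᵢ)/(1−Qω²xᵢ)`. -/
theorem one_sub_q_sig : 1 - T.q x * T.sig x =
    (1 - T.q x * T.ω x ^ 2) * (1 - T.q x * T.ω x * x T.i) / (1 - T.q x * T.ω x ^ 2 * x T.i) := by
  rw [sig]
  set d := 1 - T.q x * T.ω x ^ 2 * x T.i with hd_def
  have hd : d ≠ 0 := (one_sub_qωωxi_pos hx).ne'
  rw [eq_div_iff hd, ← mul_div_assoc, sub_div' hd, div_mul_cancel₀ _ hd, hd_def]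
  ring

/-- Auxiliary (telescope step): `sq_lt_sig`. -/
theorem sq_lt_sig : T.ω x ^ 2 < T.sig x := by
  have h := sig_sub_sq hx
  have hpos : 0 < x T.i * T.ω x * (1 - T.ω x) * (1 - T.q x * T.ω x ^ 2) /
      (1 - T.q x * T.ω x ^ 2 * x T.i) :=
    div_pos (mul_pos (mul_pos (mul_pos (xi_pos hx) (ω_pos hx)) (by linarith [ω_lt_one hx]))
      (one_sub_qωω_pos hx)) (one_sub_qωωxi_pos hx)
  linarith

/-- Auxiliary (telescope step): `sig_lt_ω`. -/
theorem sig_lt_ω : T.sig x < T.ω x := by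
  have h := ω_sub_sig hx
  have hpos : 0 < T.ω x * (1 - x T.i) * (1 - T.ω x) / (1 - T.q x * T.ω x ^ 2 * x T.i) :=
    div_pos (mul_pos (mul_pos (ω_pos hx) (by linarith [xi_lt_one hx]))
      (by linarith [ω_lt_one hx])) (one_sub_qωωxi_pos hx)
  linarith

/-- Auxiliary (telescope step): `sig_pos`. -/
theorem sig_pos : 0 < T.sig x := lt_trans (pow_pos (ω_pos hx) 2) (sq_lt_sig hx)
/-- Auxiliary (telescope step): `sig_lt_one`. -/
theorem sig_lt_one : T.sig x < 1 := (sig_lt_ω hx).trans (ω_lt_one hx)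

/-- `Ψ(x) ∈ D♯`. -/
theorem Ψ_mem : soloInformedRatMap T.PΨ T.QΨ x ∈ T.Ds := by
  rw [Ψ_apply]
  refine ⟨T.update_mem x hx _ (sig_pos hx) (sig_lt_one hx), ?_, ?_⟩
  · show T.ω (Function.update x T.i (T.sig x)) ^ 2 < Function.update x T.i (T.sig x) T.i
    rw [ω_update, Function.update_self]; exact sq_lt_sig hx
  · show Function.update x T.i (T.sig x) T.i < T.ω (Function.update x T.i (T.sig x))
    rw [ω_update, Function.update_self]; exact sig_lt_ω hx

end sigma

/-- The Möbius map in the active variable is injective (its determinant is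
`ω(1−ω)(1−Qω²) > 0`). -/
theorem injOn_Ψ : InjOn (soloInformedRatMap T.PΨ T.QΨ) T.D := by
  intro x hx x' hx' h
  rw [Ψ_apply, Ψ_apply] at h
  have hoff : ∀ j, j ≠ T.i → x j = x' j := fun j hj => by
    simpa [Function.update_of_ne hj] using congr_fun h j
  have hω : T.ω x' = T.ω x := (soloInformed_aeval_eq_of_eq_off T.vars_Ω hoff).symm
  have hq : T.q x' = T.q x := (soloInformed_aeval_eq_of_eq_off T.vars_Q hoff).symm
  have hi := congr_fun h T.i
  simp only [Function.update_self, sig] at hi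
  rw [hω, hq] at hi
  have h1 := (one_sub_qωωxi_pos hx).ne'
  have h2 : (1 - T.q x * T.ω x ^ 2 * x' T.i) ≠ 0 := by
    have := one_sub_qωωxi_pos hx'; rw [hω, hq] at this; exact this.ne'
  rw [div_eq_div_iff h1 h2] at hi
  have hdet : 0 < T.ω x * (1 - T.ω x) * (1 - T.q x * T.ω x ^ 2) :=
    mul_pos (mul_pos (ω_pos hx) (by linarith [ω_lt_one hx])) (one_sub_qωω_pos hx)
  have hxi : x T.i = x' T.i := by
    have : (x T.i - x' T.i) * (T.ω x * (1 - T.ω x) * (1 - T.q x * T.ω x ^ 2)) = 0 := by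
      linear_combination hi
    rcases mul_eq_zero.1 this with h0 | h0
    · linarith
    · exact absurd h0 hdet.ne'
  ext j
  by_cases hj : j = T.i
  · rw [hj]; exact hxi
  · exact hoff j hj

/-- **`Ψ(D) = D♯`** (surjectivity by the inverse Möbius map). -/
theorem image_Ψ : soloInformedRatMap T.PΨ T.QΨ '' T.D = T.Ds := by
  refine Subset.antisymm (image_subset_iff.2 fun x hx => Ψ_mem hx) fun z hz => ?_
  have hzD := hz.1
  have hω0 := ω_pos hzD
  have hω1 := ω_lt_one hzD
  have hq0 := q_nonneg hzD
  have hA := one_sub_qωω_pos hzD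
  obtain ⟨hlo, hhi⟩ : T.ω z ^ 2 < z T.i ∧ z T.i < T.ω z := hz.2
  -- the inverse: v = (s − ω²)/(ω(1−ω−Qω²) + Qω² s)
  set s := z T.i with hs
  have hden : 0 < T.ω z * (1 - T.ω z - T.q z * T.ω z ^ 2) + T.q z * T.ω z ^ 2 * s := by
    have h1 : T.q z * T.ω z ^ 2 * (T.ω z - s) ≤ 1 * (T.ω z - s) :=
      mul_le_mul_of_nonneg_right (by nlinarith) (by linarith)
    nlinarith
  set v := (s - T.ω z ^ 2) / (T.ω z * (1 - T.ω z - T.q z * T.ω z ^ 2) + T.q z * T.ω z ^ 2 * s)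
    with hv
  have hv0 : 0 < v := div_pos (by linarith) hden
  have hv1 : v < 1 := by
    rw [hv, div_lt_one hden]
    nlinarith
  refine ⟨Function.update z T.i v, T.update_mem z hzD v hv0 hv1, ?_⟩
  rw [Ψ_apply, Function.update_idem]
  have hvE : v * (T.ω z * (1 - T.ω z - T.q z * T.ω z ^ 2) + T.q z * T.ω z ^ 2 * s) =
      s - T.ω z ^ 2 := by
    rw [hv]; exact div_mul_cancel₀ _ hden.ne'
  have hsig : T.sig (Function.update z T.i v) = s := by
    rw [sig, ω_update, q_update, Function.update_self]
    have hne : (1 - T.q z * T.ω z ^ 2 * v) ≠ 0 := by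
      have : T.q z * T.ω z ^ 2 * v ≤ T.q z * T.ω z ^ 2 :=
        mul_le_of_le_one_right (mul_nonneg hq0 (sq_nonneg _)) hv1.le
      nlinarith
    rw [div_eq_iff hne]
    linear_combination hvE
  rw [hsig, hs, Function.update_eq_self]

end SoloInformedTelDatum

end Summit.KontsevichZagierPeriods.KontsevichZagierPeriods.Theorems
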